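import Summits.CriticalPhenomena.CardyFormulaZ2.Theses.CardyDualCurrent
import Literature.Probability.LatticeModels.LocalParafermionicTemplate
import Literature.Probability.LatticeModels.DiscreteCauchyLimitTwoTypes

/-!
# Stub `stub_limitHolomorphic` (crux stmt-CriticalPhenomena-11394, line `registered`)

Subsequential scaling limits of the observable of an exactly discrete-holomorphic local
parafermionic template are holomorphic "in the sum of the two edge types": if along meshes
`δ_k → 0⁺` of a `ZdDiscretisationFamily E` of a Dobrushin domain `D` the template `T` is exactly
Cauchy–Riemann in `E δ_k` (`T.IsExactCRIn (E δ_k)`) and the renormalised step functions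
`c_k · T.obs (E δ_k) ⌊w/δ_k⌋ i` converge uniformly on compacts of `D` to continuous `g i`
(`i = 0` horizontal, `i = 1` vertical edges), then `g 0 + g 1` is holomorphic on `D`.

This is Smirnov's Morera step (Smirnov 2010, Remark 3.3 and §5) for templates, via the general
two-type discrete-Cauchy-to-continuum-Cauchy lemma `wedgeIntegral_add_eq_zero_of_cr_twoTypes`
(`Literature/Probability/LatticeModels/DiscreteCauchyLimitTwoTypes.lean`): exact CR of the
template at deep stencils (`cr_of_isExactCRIn`), a metric deep radius for compacts along a
discretisation family (`exists_deep_radius`: for small mesh every stencil near a compact of `D`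
is `T.r`-deep), and Morera (`Complex.isConservativeOn_and_continuousOn_iff_isDifferentiableOn`).
Only the SUM is holomorphic (`g 0 - g 1` is anti-holomorphic in general).
-/

noncomputable section

namespace Summit.CriticalPhenomena.CardyFormulaZ2.Cruxes.CanonicalLimitFromExactCR.Birth

open scoped BigOperators Topology
open Filter Set Metric Complex
open Literature.Probability.LatticeModels Literature.Probability.RandomPlanarGeometry
open Literature.Probability.LatticeModels.DiscreteDobrushin (supNear supNear_self supNear_mono
  supNear_of_adj dist_meshPoint_le_of_supNear IsBulkRegion)

namespace LimitHolomorphic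

/-- **Exact CR of the template in `Dd` gives `CRVertex`/`CRFace` of the lifted observable at
every site all of whose neighbours within sup-distance `1` are deep (both types).** [folklore] -/
theorem cr_of_isExactCRIn {T : LocalParafermionicTemplate} {Dd : DiscreteDobrushin}
    (hCR : T.IsExactCRIn Dd) {v : Site 2} (hv : ∀ z, supNear v 1 z → ∀ i, T.IsDeep Dd z i) :
    CRVertex (typedEdgeFun (T.obs Dd)) v ∧ CRFace (typedEdgeFun (T.obs Dd)) v := by
  have hs : ∀ k : Fin 4, supNear v 1 (v + cornerUnit k) := fun k i => by
    fin_cases i <;> fin_cases k <;> simp [cornerUnit]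
  have h0 : supNear v 1 v := supNear_self v zero_le_one
  have e2 : v - Pi.single 0 1 = v + cornerUnit 2 := by simp [cornerUnit, sub_eq_add_neg]
  have e3 : v - Pi.single 1 1 = v + cornerUnit 3 := by simp [cornerUnit, sub_eq_add_neg]
  have e0 : v + Pi.single 0 1 = v + cornerUnit 0 := rfl
  have e1 : v + Pi.single 1 1 = v + cornerUnit 1 := rfl
  constructor
  · refine crVertex_typedEdgeFun (hCR.1 v (hv v h0 0) (hv v h0 1) ?_ ?_)
    · rw [e2]; exact hv _ (hs 2) 0
    · rw [e3]; exact hv _ (hs 3) 1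
  · refine crFace_typedEdgeFun (hCR.2 v (hv v h0 0) ?_ (hv v h0 1) ?_)
    · rw [e1]; exact hv _ (hs 1) 0
    · rw [e0]; exact hv _ (hs 0) 1

/-! ### Deep radius of a compact along a discretisation family -/

/-- **Metric deep radius.** For a discretisation family `E` of `D`, a radius `R` and a compact
`K ⊆ D` there is `ρ > 0` such that, for all small `δ > 0`, every site whose mesh point is within
`ρ` of a mesh point in `K` is `R`-deep in `E δ` for both edge types (its whole translated medial
ball of radius `R` consists of interior medial vertices). [folklore] -/
theorem exists_deep_radius {D : DobrushinDomain} {E : ℝ → DiscreteDobrushin}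
    (hDE : ZdDiscretisationFamily D E) (R : ℕ) {K : Set ℂ} (hK : IsCompact K)
    (hKD : K ⊆ D.carrier) :
    ∃ ρ > 0, ∀ᶠ δ in 𝓝[>] (0 : ℝ), ∀ x y : Site 2, meshPoint δ x ∈ K →
      dist (meshPoint δ y) (meshPoint δ x) ≤ ρ → ∀ i : Fin 2, (E δ).IsDeepAt y i R := by
  obtain ⟨r, hr, hrD⟩ := hK.exists_cthickening_subset_open D.isOpen hKD
  refine ⟨r / 4, by positivity, ?_⟩
  set K₁ := cthickening (r / 2) K with hK₁def
  have hK₁ : IsCompact K₁ := hK.cthickening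
  have hK₁D : K₁ ⊆ D.carrier := (cthickening_mono (by linarith) K).trans hrD
  have h1 : ∀ᶠ δ in 𝓝[>] (0 : ℝ), ∀ z : Site 2, meshPoint δ z ∈ K₁ → z ∈ meshDomain D.carrier δ :=
    (JordanDomain.eventually_forall_mem_meshDomain' D.toJordanDomain hK₁ hK₁D).mono
      fun δ h => h.1
  have hc : (0 : ℝ) < r / (8 * ((R : ℝ) + 4)) := by positivity
  have h2 : ∀ᶠ δ in 𝓝[>] (0 : ℝ), δ < r / (8 * ((R : ℝ) + 4)) := nhdsWithin_le_nhds (Iio_mem_nhds hc)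
  have h3 : ∀ᶠ δ in 𝓝[>] (0 : ℝ), 0 < δ := self_mem_nhdsWithin
  filter_upwards [h1, h2, h3] with δ hδ1 hδ2 hδ3 x y hx hy i
  have hR4 : (0 : ℝ) < (R : ℝ) + 4 := by positivity
  have hδr : δ * (8 * ((R : ℝ) + 4)) < r := by rwa [lt_div_iff₀ (by positivity)] at hδ2
  set Tset : Set (Site 2) := {z | meshPoint δ z ∈ K₁} with hT
  have hΩ : (E δ).Ω = D.carrier := hDE.Ω_eq δ
  have hδE : (E δ).δ = δ := hDE.δ_eq δ
  have hbulk : (E δ).IsBulkRegion Tset := by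
    refine ⟨fun z hz => ?_, fun v hv w hw hvw => ?_⟩
    · rw [hΩ, hδE]; exact hδ1 z hz
    · rw [hΩ, hδE, meshGraph_adj_iff]
      refine ⟨hvw, ?_⟩
      have hdw : dist (meshPoint δ w) (meshPoint δ v) ≤ 2 * δ := by
        have := dist_meshPoint_le_of_supNear hδ3.le (supNear_of_adj hvw)
        push_cast at this; linarith
      have h2δ : 0 ≤ 2 * δ := by linarith
      have hball : closedBall (meshPoint δ v) (2 * δ) ⊆ D.carrier := by
        intro p hp
        have hp' : p ∈ cthickening (2 * δ) K₁ :=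
          Metric.mem_cthickening_of_dist_le p (meshPoint δ v) (2 * δ) K₁ hv (mem_closedBall.1 hp)
        have : cthickening (2 * δ) K₁ ⊆ cthickening r K :=
          (cthickening_cthickening_subset h2δ (by positivity) K).trans
            (cthickening_mono (by nlinarith) K)
        exact hrD (this hp')
      refine ((convex_closedBall _ _).segment_subset (mem_closedBall_self h2δ)
        (mem_closedBall.2 hdw)).trans ?_
      exact hball.trans subset_closure
  -- every site within sup-distance `R + 3` of `y` is in `Tset`
  have hnear : ∀ z, supNear y ((R : ℤ) + 3) z → z ∈ Tset := by
    intro z hz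
    have hdz : dist (meshPoint δ z) (meshPoint δ y) ≤ δ * (2 * ((R : ℝ) + 3)) := by
      have := dist_meshPoint_le_of_supNear hδ3.le hz; push_cast at this; linarith
    have hdist : dist (meshPoint δ z) (meshPoint δ x) ≤ r / 2 :=
      calc dist (meshPoint δ z) (meshPoint δ x)
          ≤ dist (meshPoint δ z) (meshPoint δ y) + dist (meshPoint δ y) (meshPoint δ x) :=
            dist_triangle _ _ _
        _ ≤ δ * (2 * ((R : ℝ) + 3)) + r / 4 := add_le_add hdz hy
        _ ≤ r / 2 := by nlinarith
    exact Metric.mem_cthickening_of_dist_le _ _ _ _ hx hdist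
  -- the translated ball
  intro e he
  obtain ⟨hedge, hcoord⟩ := LocalParafermionicTemplate.mem_edgeSet_and_coord_bound_of_edist_le he
  revert hedge hcoord
  refine Sym2.ind (fun a b => ?_) e
  intro hedge hcoord
  have hab : (zdGraph 2).Adj a b := (SimpleGraph.mem_edgeSet _).1 hedge
  have hsa : supNear y ((R : ℤ) + 1) (a + y) := fun j => by
    have := hcoord a (Sym2.mem_mk_left a b) j; simpa using this
  have hsb : supNear y ((R : ℤ) + 1) (b + y) := fun j => by
    have := hcoord b (Sym2.mem_mk_right a b) j; simpa using this
  have hTa : ∀ z, supNear (a + y) 2 z → z ∈ Tset := fun z hz =>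
    hnear z (fun j => by have h := (hsa.trans hz) j; linarith)
  have hTb : ∀ z, supNear (b + y) 2 z → z ∈ Tset := fun z hz =>
    hnear z (fun j => by have h := (hsb.trans hz) j; linarith)
  have ha0 : a + y ∈ Tset := hTa _ (supNear_self _ (by norm_num))
  have hb0 : b + y ∈ Tset := hTb _ (supNear_self _ (by norm_num))
  have hnba : a + y ∉ (E δ).zdBoundary := hbulk.not_mem_zdBoundary hTa
  have hnbb : b + y ∉ (E δ).zdBoundary := hbulk.not_mem_zdBoundary hTb
  rw [Sym2.map_mk, DiscreteDobrushin.mem_innerMedialVertices_iff]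
  refine ⟨(SimpleGraph.mem_edgeSet _).2 (hbulk.discreteAdj ha0 hb0
    (LocalParafermionicTemplate.zdGraph_adj_add_right hab y)), ?_⟩
  intro v hv
  rcases Sym2.mem_iff.1 hv with rfl | rfl
  · exact ⟨fun h => hnba ((E δ).zdArcA_subset_zdBoundary h),
      fun h => hnba ((E δ).zdArcB_subset_zdBoundary h)⟩
  · exact ⟨fun h => hnbb ((E δ).zdArcA_subset_zdBoundary h),
      fun h => hnbb ((E δ).zdArcB_subset_zdBoundary h)⟩

/-! ### Morera: the limit of the template observable is holomorphic in the sum of the two types -/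

/-- The lattice point read by the crux's step function at a mesh point is the site itself:
`⌊(δ x)_j / δ⌋ = x_j`. [folklore] -/
theorem floorSite_meshPoint {δ : ℝ} (hδ : δ ≠ 0) (x : Site 2) :
    (fun j : Fin 2 => ⌊(if j = 0 then (meshPoint δ x).re else (meshPoint δ x).im) / δ⌋) = x := by
  funext j
  fin_cases j
  · simp [meshPoint_re, mul_div_cancel_left₀ _ hδ]
  · simp [meshPoint_im, mul_div_cancel_left₀ _ hδ]

/-- **Subsequential limits of a renormalised exactly-CR template observable are holomorphic in
the sum of the two edge types** (Smirnov 2010, §5, Morera step, for templates): along meshes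
`s k → 0⁺` of a discretisation family `E` of `D`, if `T` is exactly Cauchy–Riemann in `E (s k)`
for all large `k` and `c k · T.obs (E (s k)) ⌊w/s k⌋ i → g i` uniformly on compacts of `D` with
`g i` continuous (`i = 0, 1`), then `g 0 + g 1` is holomorphic on `D`.
[cite: Smirnov2010, §5 (proof of Theorem 2.2, Morera step)] -/
theorem differentiableOn_add_of_limit (T : LocalParafermionicTemplate) {D : DobrushinDomain}
    {E : ℝ → DiscreteDobrushin} (hDE : ZdDiscretisationFamily D E) {s : ℕ → ℝ}
    (hs : Tendsto s atTop (𝓝[>] (0 : ℝ))) (hCR : ∀ᶠ k in atTop, T.IsExactCRIn (E (s k)))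
    (c : ℕ → ℂ) {g : Fin 2 → ℂ → ℂ} (hg : ∀ i, ContinuousOn (g i) D.carrier)
    (hconv : ∀ (i : Fin 2) (K : Set ℂ), K ⊆ D.carrier → IsCompact K →
      TendstoUniformlyOn (fun (k : ℕ) (w : ℂ) => c k *
        T.obs (E (s k)) (fun j => ⌊(if j = 0 then w.re else w.im) / s k⌋) i) (g i) atTop K) :
    DifferentiableOn ℂ (fun w => g 0 w + g 1 w) D.carrier := by
  -- main case: ordered corners
  have main : ∀ z w : ℂ, z.re ≤ w.re → z.im ≤ w.im → Rectangle z w ⊆ D.carrier →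
      wedgeIntegral z w (fun ζ => g 0 ζ + g 1 ζ) + wedgeIntegral w z (fun ζ => g 0 ζ + g 1 ζ) = 0 := by
    intro z w hre him hR
    have hRc : IsCompact (Rectangle z w) := isCompact_uIcc.reProdIm isCompact_uIcc
    obtain ⟨r, hr, hrD⟩ := hRc.exists_cthickening_subset_open D.isOpen hR
    set K := cthickening r (Rectangle z w) with hKdef
    have hK : IsCompact K := hRc.cthickening
    have hKD : K ⊆ D.carrier := hrD
    obtain ⟨ρ, hρ, hdeep⟩ := exists_deep_radius hDE T.r hK hKD
    have hsmall : ∀ᶠ δ in 𝓝[>] (0 : ℝ), δ < min (r / 3) (ρ / 2) :=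
      nhdsWithin_le_nhds (Iio_mem_nhds (by positivity))
    have hall := (hs.eventually (hdeep.and (hsmall.and
      (self_mem_nhdsWithin : ∀ᶠ δ in 𝓝[>] (0 : ℝ), 0 < δ)))).and hCR
    obtain ⟨k₀, hk₀⟩ := eventually_atTop.1 hall
    -- shift the sequence
    set s' : ℕ → ℝ := fun k => s (k + k₀) with hs'
    have hk : ∀ k, ((∀ x y : Site 2, meshPoint (s' k) x ∈ K →
        dist (meshPoint (s' k) y) (meshPoint (s' k) x) ≤ ρ → ∀ i : Fin 2, (E (s' k)).IsDeepAt y i T.r) ∧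
        (s' k < min (r / 3) (ρ / 2) ∧ 0 < s' k)) ∧ T.IsExactCRIn (E (s' k)) :=
      fun k => hk₀ (k + k₀) (Nat.le_add_left _ _)
    have hs'0 : ∀ k, 0 < s' k := fun k => (hk k).1.2.2
    have hs'lim : Tendsto s' atTop (𝓝 0) :=
      (hs.mono_right nhdsWithin_le_nhds).comp (tendsto_add_atTop_nat k₀)
    -- the data of the generic lemma
    set F : ℕ → MedialVertex → ℂ := fun k => typedEdgeFun (T.obs (E (s' k))) with hF
    set u : Fin 2 → ℕ → ℂ → ℂ := fun i k w => c (k + k₀) *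
      T.obs (E (s' k)) (fun j => ⌊(if j = 0 then w.re else w.im) / s' k⌋) i with hu
    have hconv' : ∀ i, TendstoUniformlyOn (u i) (g i) atTop K := fun i =>
      tendstoUniformlyOn_shift (hconv i K hKD hK) k₀
    have huF : ∀ (i : Fin 2) k (x : Site 2), ((s' k : ℂ) * c (k + k₀)) * T.obs (E (s' k)) x i =
        (s' k : ℂ) * u i k (meshPoint (s' k) x) := by
      intro i k x
      simp only [hu, floorSite_meshPoint (hs'0 k).ne' x]
      ring
    refine wedgeIntegral_add_eq_zero_of_cr_twoTypes hs'0 hs'lim hre him hK ((hg 0).mono hKD)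
      ((hg 1).mono hKD) hr Subset.rfl F (fun k => (s' k : ℂ) * c (k + k₀)) (u 0) (u 1)
      (fun k x => ?_) (fun k x => ?_) (hconv' 0) (hconv' 1) (fun k => ?_) (fun k x hx => ?_)
    · simp only [hF, typedEdgeFun_cSrc_zero]; exact huF 0 k x
    · simp only [hF, typedEdgeFun_cSrc_one]; exact huF 1 k x
    · have := (hk k).1.2.1; have := min_le_left (r / 3) (ρ / 2); linarith
    · refine cr_of_isExactCRIn (hk k).2 fun y hy i => ?_
      refine (hk k).1.1 x y hx ?_ i
      have h1 := dist_meshPoint_le_of_supNear (hs'0 k).le hy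
      have h2 := (hk k).1.2.1
      have h3 := min_le_right (r / 3) (ρ / 2)
      push_cast at h1
      linarith
  -- all corner configurations
  have aux : ∀ z w : ℂ, z.re ≤ w.re → Rectangle z w ⊆ D.carrier →
      wedgeIntegral z w (fun ζ => g 0 ζ + g 1 ζ) + wedgeIntegral w z (fun ζ => g 0 ζ + g 1 ζ) = 0 := by
    intro z w hre hR
    rcases le_total z.im w.im with him | him
    · exact main z w hre him hR
    · have hR' : Rectangle (⟨z.re, w.im⟩ : ℂ) ⟨w.re, z.im⟩ ⊆ D.carrier := by
        rwa [rectangle_eq_of_diag]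
      have h := main ⟨z.re, w.im⟩ ⟨w.re, z.im⟩ hre him hR'
      rw [Complex.wedgeIntegral_add_wedgeIntegral_eq] at h ⊢
      simp only at h
      rw [intervalIntegral.integral_symm z.im w.im, intervalIntegral.integral_symm z.im w.im] at h
      linear_combination (-1 : ℂ) * h
  refine ((Complex.isConservativeOn_and_continuousOn_iff_isDifferentiableOn D.isOpen).1
    ⟨?_, (hg 0).add (hg 1)⟩)
  intro z w hR
  rcases le_total z.re w.re with hre | hre
  · exact eq_neg_of_add_eq_zero_left (aux z w hre hR)
  · have hR' : Rectangle w z ⊆ D.carrier := by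
      rwa [show Rectangle w z = Rectangle z w by simp [Rectangle, Set.uIcc_comm]]
    have h := aux w z hre hR'
    rw [add_comm] at h
    exact eq_neg_of_add_eq_zero_left h

end LimitHolomorphic

/-! ### The registered stub -/

/-- stub `stub_limitHolomorphic` (Morera step for templates; Smirnov 2010 §5 at `σ = 1/3`):
for every local parafermionic template `T`, every Dobrushin domain `D`, every
`ZdDiscretisationFamily E` of `D`, every sequence of meshes `s k → 0⁺` along which `T` is
exactly Cauchy–Riemann in `E (s k)` (eventually), every normalisers `c k` and continuous
`g 0, g 1` on `D`: if `c k · T.obs (E (s k)) ⌊w / s k⌋ i → g i` uniformly on compacts of `D`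
(`i = 0, 1`), then `g 0 + g 1` is holomorphic on `D`. -/
theorem stub_limitHolomorphic :
    (∀ (T : Literature.Probability.LatticeModels.LocalParafermionicTemplate) (D : Literature.Probability.RandomPlanarGeometry.DobrushinDomain) (E : ℝ → Literature.Probability.LatticeModels.DiscreteDobrushin), Literature.Probability.LatticeModels.ZdDiscretisationFamily D E → ∀ (s : ℕ → ℝ), Filter.Tendsto s Filter.atTop (𝓝[>] (0 : ℝ)) → (∀ᶠ k in Filter.atTop, T.IsExactCRIn (E (s k))) → ∀ (c : ℕ → ℂ) (g : Fin 2 → ℂ → ℂ), (∀ i, ContinuousOn (g i) D.carrier) → (∀ (i : Fin 2) (K : Set ℂ), K ⊆ D.carrier → IsCompact K → TendstoUniformlyOn (fun (k : ℕ) (w : ℂ) => c k * T.obs (E (s k)) (fun j => ⌊(if j = 0 then w.re else w.im) / s k⌋) i) (g i) Filter.atTop K) → DifferentiableOn ℂ (fun w => g 0 w + g 1 w) D.carrier) := by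
  intro T D E hDE s hs hCR c g hg hconv
  exact LimitHolomorphic.differentiableOn_add_of_limit T hDE hs hCR c hg hconv

end Summit.CriticalPhenomena.CardyFormulaZ2.Cruxes.CanonicalLimitFromExactCR.Birth

end
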